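import Literature.Computability.AlgebraicComplexity.BDI20Sec8MapsFP
import Literature.Computability.AlgebraicComplexity.BDI20Thm30OfGridLike
import Literature.Computability.AlgebraicComplexity.BDI20HwvETHTransfer
import HarnessLib

/-!
# Bläser–Dörfler–Ikenmeyer 2020, Thm 30 (CCC 2021 Thm 8.9): NP-hardness and the ETH clause for
# SEMISTANDARD tableaux at the Waring-rank-5 point — the closers, modulo Lemma 29's regularisation

M. Bläser, J. Dörfler, C. Ikenmeyer, *On the complexity of evaluating highest weight vectors*,
arXiv:2002.11594 (= CCC 2021, LIPIcs 200:29), §8 Thm 30. Cell `val-lit`, seat x6 g8 (closer-owner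
of the §8 programme, lead-np RULINGS (124)/(125); file "F" of `HOME/np/NOTE-x6g8-BDI20-sec8-LAYOUT.md`).

THE PRINTED PROOF (Thm 30, arXiv TeX L2399–2512): GRAPH 3-COLOURABILITY →(Lemma 28: relational
colouring of grid subgraphs) →(Lemma 29 = Lemma 26 2nd half: 8-regular grid-like layered multigraphs)
→(Lemma 25: the semistandard pair `T̂_↕, T̂_↔`) →(Thm 30's tableau `T₁…T₅`, doubled) → the
evaluation problem; NP-hardness by composition, and "assuming ETH, … can not be computed in time
`2^{o(√ℓ)}`" because the number of labels is `ℓ = O(|V(G)|) = O(m²)` on the sparsified `3`-SAT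
graphs. In the tree: Lemma 28 ↦ the CROSSBAR `Crossbar.crossbar V adj` (FILE C′, disclosed layout
deviation, `isRelColourable_crossbar_iff`); Lemma 25 + Thm 30 ↦ FILES A, E and the glue
(`GridLikeLayered.tableau_mem_nonvanishingSetSemistd_iff`); the maps on codes ↦ `BDI20Sec8MapsFP`;
the ETH transfer ↦ `BDI20ETH.not_hasSubexpDecider_of_codeFP`. Lemma 29 (FILE D, t20) is consumed
through the `Type`-valued interface `Sec8.Regularisation` (§H.1): its size / graph / 8-regularity /
colouring equivalence / `O(V²)` bound / polynomial-time data. THIS FILE PROVES, for every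
`K : Sec8.Regularisation`:

* ★ `Sec8.Regularisation.thm_8_9_of_regularisation K : BDI2020_thm_8_9` — `THREECOL` (NP-hard,
  `ThreeColouring.THREECOL_isNPHard`) `≤ₚ` Thm 8.9's language for every `d = 16k ≥ 16`, `m ≥ 5`
  (`THREECOL_karpReducible`; the Karp map `reduceNP` on all strings, graph codes decoded as in the
  Thm 8.1 file, polynomial time by `instFP`);
* ★ `Sec8.Regularisation.thm_8_9_eth_of_regularisation K : BDI2020_thm_8_9_eth` — the Karp map
  `reduceETH` from `3`-SAT codes through the linear-size graph `BDI20SatGraph.cnfAdj φ` (`9 + 32m`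
  vertices), with `√(#labels) - 1 ≤ ethConst · m` (`sqrt_numLabels_reduceETH_le`), fed to
  `BDI20ETH.not_hasSubexpDecider_of_codeFP` with `g = Nat.sqrt`.

So the discharges `BDI2020_thm_8_9_holds := Sec8.Regularisation.thm_8_9_of_regularisation <FILE D's
kit>` and `BDI2020_thm_8_9_eth_holds := …eth_of_regularisation <kit>` are ONE instantiation away
(FILE D: `regularise`/`regulariseAlong` + its data on codes). `Sec8.Regularisation` is a structure
of data and proofs, not a `Prop`-valued named fact; no conjecture, no `instance`, no notation;
`0` sorries; census +0 (the two `_holds` are not in this file).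

HONEST FRAMING: an NP- and ETH-hardness transcription about EVALUATING highest weight vectors; it says
nothing about `VP ≠ VNP`, which is NOT proved; ETH is a hypothesis of the second clause.

## References
* [BlaserDorflerIkenmeyer2020] arXiv:2002.11594 Thm 30, Lemmas 25, 28, 29 (= CCC 2021 Thm 8.9,
  Lemmas 8.4, 8.7, 8.8).
* [GareyJohnsonStockmeyer1976] TCS 1 (1976), Thm 2.1 (3-SAT ∝ GRAPH 3-COLOURABILITY, degree ≤ 4).
* [ImpagliazzoPaturiZaneJCSS2001] JCSS 63 (2001), §2.1 (SERF reductions), Cor. 2.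
* [AroraBarak2009] CUP 2009, §0.1 (codes), §1.3 (polynomial time), Def. 2.7 (Karp reductions).
-/

namespace Literature.Computability.AlgebraicComplexity

namespace BDI2020

namespace Sec8

open Literature.Computability.Complexity CodeFP GridLikeLayered

/-! ### §H.1 The interface to Lemma 29 (FILE D: the 8-regularisation of the crossbar) -/

/-- **What the closers consume from Lemma 29** (BDI arXiv Lemma 29 = Lemma 26, 2nd half; the tree's
FILE D, t20): for every input graph `(V, adj)` an `8`-regular grid-like layered multigraph (Def. 24)
on `size V adj = O(V²)` vertices which is properly `3`-colourable iff the crossbar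
`Crossbar.crossbar V adj` (Lemma 28's relational instance, FILE C′) is relationally `3`-colourable,
whose size, positions and multiplicities are computed in polynomial time from `V` (binary, below a
unary budget) and `adj` given on codes. A `Type`-valued record of data and proofs — NOT a named
fact; it is to be inhabited by FILE D's construction.
[cite: BlaserDorflerIkenmeyer2020, Lemma 29 with Lemma 26 (arXiv; = CCC 2021 Lemma 8.8 with Lemma 8.5)] -/
structure Regularisation where
  /-- the number of vertices of the regularised crossbar -/
  size : ℕ → (ℕ → ℕ → Bool) → ℕ
  /-- the regularised crossbar (Def. 24 data and proofs) -/
  graph : (V : ℕ) → (adj : ℕ → ℕ → Bool) → GridLikeLayered (size V adj)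
  /-- "the resulting graph is 8-regular" -/
  isRegular : ∀ V adj, (graph V adj).IsRegular 8
  /-- "admits a relational 3-coloring … iff the resulting graph … is 3-colorable" -/
  colourable_iff : ∀ V adj, (∃ c, (graph V adj).IsProper3 c) ↔ (Crossbar.crossbar V adj).IsRelColourable
  /-- the size constant -/
  C : ℕ
  /-- "polynomially many vertices": `O(V²)` -/
  size_le : ∀ V adj, size V adj ≤ C * (V + 1) ^ 2
  /-- the size on codes -/
  sizeFP : ∀ {σ : Type} {eσ : σ → List Bool} {Vf Uf : σ → ℕ} {adjf : σ → ℕ → ℕ → Bool},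
    CodeFP eσ natE Vf → CodeFP eσ unE Uf → (∀ s, Vf s ≤ Uf s) →
    CodeFP (pairE eσ (pairE natE natE)) bitE (fun q => adjf q.1 q.2.1 q.2.2) →
    CodeFP eσ natE (fun s => size (Vf s) (adjf s))
  /-- the positions on codes -/
  posFP : ∀ {σ : Type} {eσ : σ → List Bool} {Vf Uf : σ → ℕ} {adjf : σ → ℕ → ℕ → Bool},
    CodeFP eσ natE Vf → CodeFP eσ unE Uf → (∀ s, Vf s ≤ Uf s) →
    CodeFP (pairE eσ (pairE natE natE)) bitE (fun q => adjf q.1 q.2.1 q.2.2) →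
    CodeFP (pairE eσ natE) (pairE natE natE) (fun q => GridCols.posOf (graph (Vf q.1) (adjf q.1)) q.2)
  /-- the multiplicities on codes -/
  multFP : ∀ {σ : Type} {eσ : σ → List Bool} {Vf Uf : σ → ℕ} {adjf : σ → ℕ → ℕ → Bool},
    CodeFP eσ natE Vf → CodeFP eσ unE Uf → (∀ s, Vf s ≤ Uf s) →
    CodeFP (pairE eσ (pairE natE natE)) bitE (fun q => adjf q.1 q.2.1 q.2.2) →
    CodeFP (pairE eσ (pairE natE natE)) natE
      (fun q => GridCols.multOf (graph (Vf q.1) (adjf q.1)) q.2.1 q.2.2)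

namespace Regularisation

variable (K : Regularisation)

/-! ### §H.2 The instance of an input graph: Thm 30's tableau of the regularised crossbar -/

/-- **The instance** `T̂(k; V, adj)`: Thm 30's tableau (degree `16k`) of the column lists of the
`8`-regularised crossbar of `(V, adj)`. [cite: BlaserDorflerIkenmeyer2020, Thm 30 (proof) with Lemmas 25, 28, 29 (arXiv; = CCC 2021 Thm 8.9)] -/
def inst (k V : ℕ) (adj : ℕ → ℕ → Bool) : List (List ℕ) :=
  Thm30.tableau k
    (GridCols.interColsN (K.size V adj) (GridCols.posOf (K.graph V adj)) (GridCols.multOf (K.graph V adj)))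
    (GridCols.intraColsN (K.size V adj) (GridCols.posOf (K.graph V adj)) (GridCols.multOf (K.graph V adj)))

/-- The instance is Thm 30's tableau of `(T̂_↕, T̂_↔)` of the regularised crossbar. [cite: BlaserDorflerIkenmeyer2020, Lemma 25 (arXiv; = CCC 2021 Lemma 8.4)] -/
theorem inst_eq (k V : ℕ) (adj : ℕ → ℕ → Bool) :
    K.inst k V adj = Thm30.tableau k (K.graph V adj).interCols (K.graph V adj).intraCols := by
  unfold inst
  rw [GridCols.interColsN_eq, GridCols.intraColsN_eq]

/-- **Correctness of the instance**: for `k ≥ 1`, `m ≥ 5`, `T̂(k; V, adj)` is a yes-instance of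
Thm 8.9's problem iff the input graph on `{0, …, V-1}` is properly `3`-colourable.
[cite: BlaserDorflerIkenmeyer2020, Thm 30 (proof) with Lemmas 28, 29 (arXiv; = CCC 2021 Thm 8.9)] -/
theorem inst_mem_iff {k m : ℕ} (hk : 0 < k) (hm : 5 ≤ m) (V : ℕ) (adj : ℕ → ℕ → Bool) :
    K.inst k V adj ∈ nonvanishingSetSemistd (16 * k) m ↔ ∃ col : ℕ → Fin 3, Crossbar.IsProperFor V adj col := by
  rw [inst_eq, (K.graph V adj).tableau_mem_nonvanishingSetSemistd_iff (K.isRegular V adj) hk hm,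
    K.colourable_iff, Crossbar.isRelColourable_crossbar_iff]

/-! ### §H.3 The number of labels of the instance is `O(V²)` -/

/-- `Σ_{v < N} #v(c) = |c|` for a column with entries below `N`. [folklore] -/
private theorem sum_count_eq_length {N : ℕ} (c : List ℕ) (hc : ∀ u ∈ c, u < N) :
    ∑ v ∈ Finset.range N, c.count v = c.length := by
  induction c with
  | nil => simp
  | cons a c ih =>
    have ha : a < N := hc a (by simp)
    simp only [List.count_cons, Finset.sum_add_distrib, List.length_cons,
      ih (fun u hu => hc u (by simp [hu]))]
    congr 1
    rw [Finset.sum_eq_single a (fun b _ hb => by simp [Ne.symm hb]) (fun h => absurd (Finset.mem_range.2 ha) h)]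
    simp

/-- Swapping a list sum with a finite sum. [folklore] -/
private theorem list_sum_finset_sum_comm {N : ℕ} (S : List (List ℕ)) (f : ℕ → List ℕ → ℕ) :
    (S.map fun c => ∑ v ∈ Finset.range N, f v c).sum = ∑ v ∈ Finset.range N, (S.map (f v)).sum := by
  induction S with
  | nil => simp
  | cons c S ih => simp only [List.map_cons, List.sum_cons, ih, Finset.sum_add_distrib]

/-- **`|T̂_↕| ≤ 4 N`** for an `8`-regular two-row instance (double counting of the `2`-box columns).
[cite: BlaserDorflerIkenmeyer2020, Lemma 25 (arXiv; = CCC 2021 Lemma 8.4)] -/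
theorem length_inter_le {N : ℕ} {S S' : List (List ℕ)} (h : Thm30.IsTwoRowInstance N S S') :
    S.length ≤ 4 * N := by
  have h2 : (S.map List.length).sum = 2 * S.length := by
    rw [List.map_congr_left (fun c hc => h.length_inter c hc), List.map_const', List.sum_replicate,
      smul_eq_mul, mul_comm]
  have h3 : (S.map List.length).sum = ∑ v ∈ Finset.range N, (S.map (List.count v)).sum := by
    rw [← list_sum_finset_sum_comm S (fun v c => c.count v)]
    exact congrArg List.sum (List.map_congr_left fun c hc => (sum_count_eq_length c (h.lt_inter c hc)).symm)
  have h4 : ∀ v ∈ Finset.range N, (S.map (List.count v)).sum ≤ 8 := fun v hv => by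
    have hd := h.degree v (Finset.mem_range.1 hv)
    rw [List.map_append, List.sum_append] at hd
    omega
  have h5 : ∑ v ∈ Finset.range N, (S.map (List.count v)).sum ≤ 8 * N := by
    refine (Finset.sum_le_sum h4).trans ?_
    rw [Finset.sum_const, Finset.card_range, smul_eq_mul, mul_comm]
  omega

/-- **The number of labels of the instance is at most `5 · size + 16`.**
[cite: BlaserDorflerIkenmeyer2020, Thm 30 (proof: "ℓ ∈ O(|V(G)|)") (arXiv; = CCC 2021 Thm 8.9)] -/
theorem numLabels_inst_le (k V : ℕ) (adj : ℕ → ℕ → Bool) :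
    numLabels (K.inst k V adj) ≤ 5 * K.size V adj + 16 := by
  have h := GridLikeLayered.isTwoRowInstance (K.graph V adj) (K.isRegular V adj)
  rw [inst_eq]
  refine (BDI20SatGraph.numLabels_le_of_forall_lt (N := Thm30.nLabels (K.size V adj) (K.graph V adj).interCols)
    (by unfold Thm30.nLabels; omega) (Thm30.lt_of_mem_tableau h k)).trans ?_
  have h1 := Thm30.nLabels_le (N := K.size V adj) (S := (K.graph V adj).interCols)
  have h2 := length_inter_le h
  omega

end Regularisation

end Sec8

namespace Sec8

namespace Regularisation

open Literature.Computability.Complexity CodeFP GridLikeLayered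

variable (K : Regularisation)

/-! ### §H.4 The instance on codes -/

/-- Multiplicities of an `8`-regular grid-like layered multigraph are at most `8`. [cite: BlaserDorflerIkenmeyer2020, §8 ("8-regular") (arXiv; = CCC 2021 §8)] -/
theorem multOf_le {n : ℕ} (G : GridLikeLayered n) (h8 : G.IsRegular 8) (u v : ℕ) : GridCols.multOf G u v ≤ 8 := by
  unfold GridCols.multOf
  split_ifs with hu hv
  · rw [← h8 ⟨u, hu⟩]
    exact Finset.single_le_sum (f := fun w => G.mult ⟨u, hu⟩ w) (fun _ _ => Nat.zero_le _) (Finset.mem_univ _)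
  · exact Nat.zero_le _
  · exact Nat.zero_le _

/-- **The instance on codes**: from `V` (binary, below a unary budget) and `adj` given on codes,
`T̂(k; V, adj)` is computed in polynomial time (output in the tree's `tableauEncoding`).
[cite: BlaserDorflerIkenmeyer2020, Thm 30 (proof: "this reduction") (arXiv; = CCC 2021 Thm 8.9)] [cite: AroraBarak2009, §1.3] -/
theorem instFP (k : ℕ) {σ : Type} {eσ : σ → List Bool} {Vf Uf : σ → ℕ} {adjf : σ → ℕ → ℕ → Bool}
    (hV : CodeFP eσ natE Vf) (hU : CodeFP eσ unE Uf) (hVU : ∀ s, Vf s ≤ Uf s)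
    (hadj : CodeFP (pairE eσ (pairE natE natE)) bitE (fun q => adjf q.1 q.2.1 q.2.2)) :
    CodeFP eσ (tableauEncoding.encode : List (List ℕ) → List Bool) (fun s => K.inst k (Vf s) (adjf s)) := by
  have hn := K.sizeFP hV hU hVU hadj
  have hpos := K.posFP hV hU hVU hadj
  have hmult := K.multFP hV hU hVU hadj
  -- the unary budget `C (U + 1)² + 8 ≥ size, ≥ 8`
  have hU' : CodeFP eσ unE (fun s => K.C * (Uf s + 1) ^ 2 + 8) :=
    (unAdd.comp ((((unMulConst K.C).comp ((ulength unitE).comp ((unitsPow 2).comp (unSucc.comp hU))))).pair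
      (const _ (8 : ℕ)))).congr fun s => by simp
  have hnU : ∀ s, K.size (Vf s) (adjf s) ≤ K.C * (Uf s + 1) ^ 2 + 8 := fun s =>
    (K.size_le _ _).trans (by
      have := hVU s
      have h1 : (Vf s + 1) ^ 2 ≤ (Uf s + 1) ^ 2 := Nat.pow_le_pow_left (by omega) 2
      nlinarith)
  have hmultU : ∀ s u v, GridCols.multOf (K.graph (Vf s) (adjf s)) u v ≤ K.C * (Uf s + 1) ^ 2 + 8 :=
    fun s u v => (multOf_le _ (K.isRegular _ _) u v).trans (by omega)
  have hI := GridCols.interColsFP (nf := fun s => K.size (Vf s) (adjf s))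
    (Uf := fun s => K.C * (Uf s + 1) ^ 2 + 8) (posf := fun s => GridCols.posOf (K.graph (Vf s) (adjf s)))
    (multf := fun s => GridCols.multOf (K.graph (Vf s) (adjf s))) hn hU' hnU hpos hmult hmultU
  have hA := GridCols.intraColsFP (nf := fun s => K.size (Vf s) (adjf s))
    (Uf := fun s => K.C * (Uf s + 1) ^ 2 + 8) (posf := fun s => GridCols.posOf (K.graph (Vf s) (adjf s)))
    (multf := fun s => GridCols.multOf (K.graph (Vf s) (adjf s))) hn hU' hnU hpos hmult hmultU
  have hT := (Thm30.tableauFP_tabE k).comp (hI.pair hA)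
  exact hT.congr fun _ => rfl

/-! ### §H.5 The fixed no-instance and the empty yes-instance -/

/-- The fixed no-instance `[[0]]` (content `1 × 1`, never `n × 16k`). [cite: AroraBarak2009, Def. 2.7 (a fixed no-instance for non-codes)] -/
def badTab : List (List ℕ) := [[0]]

/-- `[[0]]` is not an instance of content `n × d`, `d ≥ 2`. [cite: BlaserDorflerIkenmeyer2020, Def 3 (arXiv; = CCC 2021 Def 5.1)] -/
theorem badTab_not_mem {d m : ℕ} (hd : 2 ≤ d) : badTab ∉ nonvanishingSetSemistd d m := by
  rintro ⟨n, ⟨-, -, hlt, hcount⟩, -, -⟩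
  have h0 : 0 < n := hlt [0] (by simp [badTab]) 0 (by simp)
  have h := hcount 0 h0
  simp [badTab] at h
  omega

/-- `numLabels [[0]] = 1`. [cite: BlaserDorflerIkenmeyer2020, Def 3 (arXiv; = CCC 2021 Def 5.1)] -/
theorem numLabels_badTab : numLabels badTab = 1 := by decide

/-- The empty tableau (content `0 × d`) is a yes-instance: `f = 1`. [cite: BlaserDorflerIkenmeyer2020, eq. (5.1) (arXiv; empty product)] -/
theorem nil_mem (d m : ℕ) : ([] : List (List ℕ)) ∈ nonvanishingSetSemistd d m := by
  refine ⟨0, ⟨by simp, by simp, by simp, fun u hu => by omega⟩, ⟨by simp, List.isChain_nil⟩, by simp, ?_⟩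
  unfold hwvEvalWaring placements
  simp [point₅]

/-! ### §H.6 `THREECOL ≤ₚ` Thm 8.9's language: the discharge shape of `BDI2020_thm_8_9` -/

section NP

open BDI20NPHard (hdrOf hdrOfFP isGoodCode isGoodCodeFP bitAt bitAtFP budget budgetFP vCap vrangeFP
  tabE tabE_eq bitAt_encode_iff hctxE symTest irrTest)
open Brick

/-- **The Karp map on all strings**: graph codes `⟨bin n, bits⟩` go to the instance of their graph,
every other string to `[[0]]`. [cite: BlaserDorflerIkenmeyer2020, Thm 30 (proof) (arXiv; = CCC 2021 Thm 8.9)] [cite: AroraBarak2009, Def. 2.7] -/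
def reduceNP (k : ℕ) (w : List Bool) : List (List ℕ) :=
  if isGoodCode w then K.inst k (vCap (hdrOf w)) (bitAt (hdrOf w).1 (hdrOf w).2) else badTab

/-- **The Karp map is polynomial time on codes.** [cite: BlaserDorflerIkenmeyer2020, Thm 30 (arXiv; = CCC 2021 Thm 8.9)] [cite: AroraBarak2009, §1.3] -/
theorem reduceNPFP (k : ℕ) : CodeFP strE tabE (K.reduceNP k) := by
  have hV : CodeFP hctxE natE vCap := ((natLength natE).comp vrangeFP).congr fun _ => by simp
  have hU : CodeFP hctxE unE (fun p => budget p.2) := ((ulength unitE).comp budgetFP).congr fun _ => by simp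
  have hVU : ∀ p : ℕ × List Bool, vCap p ≤ budget p.2 := fun p => by
    unfold vCap; rw [List.length_replicate]; exact min_le_right _ _
  have hI : CodeFP hctxE (tableauEncoding.encode : List (List ℕ) → List Bool)
      (fun p => K.inst k (vCap p) (bitAt p.1 p.2)) := K.instFP k hV hU hVU bitAtFP
  rw [tabE_eq] at hI
  exact (isGoodCodeFP.ite (hI.comp hdrOfFP) (const _ badTab)).congr fun w => by unfold reduceNP; rfl

/-- Proper `3`-colourings of the bit-matrix graph on `{0, …, n-1}` are the proper `3`-colourings of
the coded graph. [cite: AroraBarak2009, §0.1 (adjacency matrix)] -/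
theorem isProperFor_iff_colorable {n : ℕ} (G : SimpleGraph (Fin n)) (adj : ℕ → ℕ → Bool)
    (hadj : ∀ v w : Fin n, adj v w = true ↔ G.Adj v w) :
    (∃ col : ℕ → Fin 3, Crossbar.IsProperFor n adj col) ↔ G.Colorable 3 := by
  constructor
  · rintro ⟨col, hcol⟩
    exact ⟨SimpleGraph.Coloring.mk (fun v => col v.val) fun {v w} hvw =>
      hcol v w v.2 w.2 (fun h => hvw.ne (Fin.ext h)) ((hadj v w).2 hvw)⟩
  · rintro ⟨C⟩
    refine ⟨fun i => if h : i < n then C ⟨i, h⟩ else 0, fun i j hi hj hij hb => ?_⟩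
    simp only [hi, hj, dif_pos]
    exact C.valid ((hadj ⟨i, hi⟩ ⟨j, hj⟩).1 hb)

/-- The header of a graph code. [folklore] -/
private theorem hdrOf_encode (n : ℕ) (G : SimpleGraph (Fin n)) :
    hdrOf (encodingGraph.encode ⟨n, G⟩) = (n, (encodingGraphFin n).encode G) := by
  rw [encodingGraph_encode, hdrOf, fstF_boolPair, sndF_boolPair, bitsToNat_encodeNat]

/-- The budget dominates `n` on `n²` bits. [folklore] -/
private theorem le_budget {n : ℕ} {b : List Bool} (h : b.length = n * n) : n ≤ budget b := by
  unfold budget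
  rw [h]
  calc n ≤ n * n + 2 := by nlinarith [Nat.zero_le n]
    _ ≤ (n * n + 2) ^ 3 := Nat.le_self_pow (by norm_num) _

/-- No cap on `n²` bits. [folklore] -/
private theorem vCap_eq {n : ℕ} {b : List Bool} (h : b.length = n * n) : vCap (n, b) = n := by
  unfold vCap
  rw [List.length_replicate, min_eq_left (le_budget h)]

/-- The bit matrix of a list of `n²` bits as a `Fin n`-indexed matrix. [folklore] -/
private theorem bitAt_eq_bitOf {n : ℕ} (b : List Bool) (h : b.length = n * n) (u w : Fin n) :
    bitAt n b u w = ChromaticNP.bitOf b h u w := by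
  unfold bitAt ChromaticNP.bitOf
  rw [List.getD_eq_getElem]
  · rfl

/-- Graph codes pass the code test. [folklore] -/
private theorem isGoodCode_encode (n : ℕ) (G : SimpleGraph (Fin n)) :
    isGoodCode (encodingGraph.encode ⟨n, G⟩) = true := by
  have hlen := ChromaticNP.length_encodingGraphFin_encode G
  unfold isGoodCode
  simp only [hdrOf_encode, Bool.and_eq_true, decide_eq_true_eq]
  refine ⟨⟨⟨(encodingGraph_encode ⟨n, G⟩).symm, hlen⟩, ?_⟩, ?_⟩
  · unfold symTest
    rw [vCap_eq hlen, List.all_eq_true]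
    intro u hu
    rw [List.all_eq_true]
    intro v hv
    rw [List.mem_range] at hu hv
    rw [Bool.or_eq_true, Bool.not_eq_true']
    by_cases huv : bitAt n ((encodingGraphFin n).encode G) u v = true
    · exact Or.inr ((bitAt_encode_iff G ⟨v, hv⟩ ⟨u, hu⟩).2 ((bitAt_encode_iff G ⟨u, hu⟩ ⟨v, hv⟩).1 huv).symm)
    · exact Or.inl (by simpa using huv)
  · unfold irrTest
    rw [vCap_eq hlen, List.all_eq_true]
    intro u hu
    rw [List.mem_range] at hu
    rw [Bool.not_eq_true']
    by_contra h
    rw [Bool.not_eq_false] at h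
    exact ((bitAt_encode_iff G ⟨u, hu⟩ ⟨u, hu⟩).1 h).ne rfl

/-- **On a graph code the Karp map yields a yes-instance iff the graph is `3`-colourable** (`k ≥ 1`,
`m ≥ 5`). [cite: BlaserDorflerIkenmeyer2020, Thm 30 (proof) (arXiv; = CCC 2021 Thm 8.9)] -/
theorem reduceNP_encode_mem_iff {k m : ℕ} (hk : 0 < k) (hm : 5 ≤ m) (n : ℕ) (G : SimpleGraph (Fin n)) :
    K.reduceNP k (encodingGraph.encode ⟨n, G⟩) ∈ nonvanishingSetSemistd (16 * k) m ↔ G.Colorable 3 := by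
  rw [reduceNP, if_pos (isGoodCode_encode n G), hdrOf_encode,
    vCap_eq (ChromaticNP.length_encodingGraphFin_encode G), K.inst_mem_iff hk hm]
  exact isProperFor_iff_colorable G _ (bitAt_encode_iff G)

/-- **A string whose image is a yes-instance is the code of a `3`-colourable graph.**
[cite: BlaserDorflerIkenmeyer2020, Thm 30 (proof) (arXiv; = CCC 2021 Thm 8.9)] -/
theorem mem_THREECOL_of_reduceNP_mem {k m : ℕ} (hk : 0 < k) (hm : 5 ≤ m) {w : List Bool}
    (hw : K.reduceNP k w ∈ nonvanishingSetSemistd (16 * k) m) : w ∈ THREECOL := by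
  unfold reduceNP at hw
  by_cases hc : isGoodCode w = true
  · rw [if_pos hc] at hw
    have hc' := hc
    unfold isGoodCode at hc'
    simp only [Bool.and_eq_true, decide_eq_true_eq] at hc'
    obtain ⟨⟨⟨hpair, hlen⟩, hsym⟩, hirr⟩ := hc'
    set n := (hdrOf w).1 with hn
    set b := (hdrOf w).2 with hb
    have hhdr : hdrOf w = (n, b) := rfl
    rw [hhdr] at hsym hirr hw
    unfold symTest at hsym
    rw [vCap_eq hlen, List.all_eq_true] at hsym
    unfold irrTest at hirr
    rw [vCap_eq hlen, List.all_eq_true] at hirr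
    have hs : ∀ i j, ChromaticNP.bitOf b hlen i j = true → ChromaticNP.bitOf b hlen j i = true := by
      intro i j hij
      rw [← bitAt_eq_bitOf] at hij ⊢
      have h1 := hsym i (List.mem_range.2 i.2)
      rw [List.all_eq_true] at h1
      have h2 := h1 j (List.mem_range.2 j.2)
      rw [Bool.or_eq_true, Bool.not_eq_true'] at h2
      rcases h2 with h2 | h2
      · simp only at h2; rw [h2] at hij; exact absurd hij (by simp)
      · exact h2
    have hi : ∀ i, ¬ ChromaticNP.bitOf b hlen i i = true := by
      intro i hii
      rw [← bitAt_eq_bitOf] at hii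
      have h1 := hirr i (List.mem_range.2 i.2)
      rw [Bool.not_eq_true'] at h1
      simp only at h1
      rw [h1] at hii
      exact absurd hii (by simp)
    set G := ChromaticNP.graphOfBits (ChromaticNP.bitOf b hlen)
    have hG : (encodingGraphFin n).encode G = b := ChromaticNP.encode_graphOfBits hlen hs hi
    have hbits : ∀ v u : Fin n, bitAt n b v u = true ↔ G.Adj v u := by
      intro v u
      rw [bitAt_eq_bitOf b hlen, ChromaticNP.graphOfBits_adj hs hi]
    rw [vCap_eq hlen, K.inst_mem_iff hk hm] at hw
    have hcol : G.Colorable 3 := (isProperFor_iff_colorable G _ hbits).1 hw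
    refine ⟨⟨n, G⟩, hcol, ?_⟩
    rw [encodingGraph_encode, hG]
    exact hpair
  · rw [if_neg hc] at hw
    exact absurd hw (badTab_not_mem (by omega))

include K in
open scoped Literature.Computability.Complexity.Notation in
/-- **GRAPH 3-COLOURABILITY `≤ₚ` the nonvanishing problem of BDI Thm 8.9** (semistandard tableaux
of content `n × 16k`, `≤ m` rows, at the fixed Waring-rank-`5` point), for every `k ≥ 1`, `m ≥ 5`.
[cite: BlaserDorflerIkenmeyer2020, Thm 30 (arXiv; = CCC 2021 Thm 8.9)] -/
theorem THREECOL_karpReducible {k m : ℕ} (hk : 0 < k) (hm : 5 ≤ m) :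
    THREECOL ≤ₚ tableauEncoding.toLanguage (nonvanishingSetSemistd (16 * k) m) := by
  obtain ⟨f, hf, hfr⟩ := K.reduceNPFP k
  refine ⟨f, hf, fun w => ?_⟩
  have hfw : f w = tableauEncoding.encode (K.reduceNP k w) := by rw [tabE_eq]; exact hfr w
  show w ∈ THREECOL ↔ f w ∈ tableauEncoding.toLanguage (nonvanishingSetSemistd (16 * k) m)
  rw [hfw, _root_.Computability.Encoding.mem_toLanguage_iff]
  constructor
  · rintro ⟨⟨n, G⟩, hG, rfl⟩
    exact (K.reduceNP_encode_mem_iff hk hm n G).2 hG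
  · exact K.mem_THREECOL_of_reduceNP_mem hk hm

/-- **Thm 8.9's NP-hardness clause from a regularisation** (the discharge SHAPE of
`BDI2020_thm_8_9`: `THREECOL` is NP-hard (`ThreeColouring.THREECOL_isNPHard`) and Karp-reduces to the
language; `16 ∣ d`, `d ≥ 16` is `d = 16k`, `k ≥ 1`). [cite: BlaserDorflerIkenmeyer2020, Thm 30 (arXiv; = CCC 2021 Thm 8.9)] -/
theorem thm_8_9_of_regularisation (K : Regularisation) : BDI2020_thm_8_9 := by
  intro d m hd hdvd hm
  obtain ⟨k, rfl⟩ := hdvd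
  exact IsHard.of_reducible_holds ThreeColouring.THREECOL_isNPHard (K.THREECOL_karpReducible (by omega) hm)

end NP

end Regularisation

end Sec8

namespace Sec8

namespace Regularisation

open Literature.Computability.Complexity CodeFP GridLikeLayered

variable (K : Regularisation)

/-! ### §H.7 `3`-SAT with parameter `m` and the ETH clause: the discharge shape of `BDI2020_thm_8_9_eth` -/

section ETHClause

open BDI20ETH (decCNFFP goodShape goodShapeFP goodShape_iff lengthFP ulengthFP cnfE cnfE_eq cnfAdjFP)
open BDI20SatGraph (cnfAdj nLab exists_proper_iff_satisfiable)
open BDI20NPHard (pairTest tabE tabE_eq)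
open Literature.Computability.FineGrained (kSATClauseParam kSATClauseParam_param_encode ETH)

/-- **The instance of a CNF**: the empty CNF ↦ the yes-instance `[]`, a CNF with an empty or a wide
clause ↦ the no-instance, otherwise the instance of the graph `G_φ` of
`BDI20BoundedDegreeSatGraph` on `9 + 32 m` vertices. [cite: BlaserDorflerIkenmeyer2020, Thm 30 with Thm 22 (proof) (arXiv; = CCC 2021 Thms 8.9, 8.1)] -/
def cnfInst (k : ℕ) (φ : CNF ℕ) : List (List ℕ) :=
  if goodShape φ then (if φ.isEmpty then [] else K.inst k (nLab φ.length) (cnfAdj φ)) else badTab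

/-- **The Karp map on all strings**: CNF codes go to the instance of their CNF, every other string to
the no-instance. [cite: BlaserDorflerIkenmeyer2020, Thm 30 (arXiv; = CCC 2021 Thm 8.9)] [cite: AroraBarak2009, Def. 2.7] -/
def reduceETH (k : ℕ) (x : List Bool) : List (List ℕ) :=
  if encodingCNF.encode (NegCNF.decCNF x) = x then K.cnfInst k (NegCNF.decCNF x) else badTab

/-- **The instance map on CNF codes is polynomial time.** [cite: BlaserDorflerIkenmeyer2020, Thm 30 (arXiv; = CCC 2021 Thm 8.9)] [cite: AroraBarak2009, §1.3] -/
theorem cnfInstFP (k : ℕ) : CodeFP cnfE tabE (K.cnfInst k) := by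
  have hN : CodeFP cnfE natE (fun φ : CNF ℕ => nLab φ.length) :=
    (natAdd.comp ((const _ 9).pair (natMul.comp ((const _ 32).pair lengthFP)))).congr fun _ => rfl
  have hU : CodeFP cnfE unE (fun φ : CNF ℕ => 9 + 32 * φ.length) :=
    (unAdd.comp ((const _ 9).pair ((unMulConst 32).comp ulengthFP))).congr fun _ => rfl
  have hI : CodeFP cnfE (tableauEncoding.encode : List (List ℕ) → List Bool)
      (fun φ => K.inst k (nLab φ.length) (cnfAdj φ)) :=
    K.instFP k hN hU (fun φ => by unfold nLab; exact le_rfl) cnfAdjFP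
  rw [tabE_eq] at hI
  have hE : CodeFP cnfE bitE (fun φ : CNF ℕ => φ.isEmpty) :=
    ((rawIsEmpty BDI20ETH.clauseE).comp (rawOfList BDI20ETH.clauseE)).congr fun _ => rfl
  exact (goodShapeFP.ite (hE.ite (const _ []) hI) (const _ badTab)).congr fun φ => by unfold cnfInst; rfl

/-- **The Karp map `reduceETH k` is computed on all strings by a polynomial-time function.**
[cite: BlaserDorflerIkenmeyer2020, Thm 30 (arXiv; = CCC 2021 Thm 8.9)] [cite: AroraBarak2009, §1.3, Def. 2.7] -/
theorem reduceETHFP (k : ℕ) : CodeFP strE tabE (K.reduceETH k) := by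
  have hre : CodeFP strE strE (fun x => cnfE (NegCNF.decCNF x)) := decCNFFP
  have hinj : Function.Injective strE := fun _ _ h => h
  have htest : CodeFP strE bitE (fun x => decide (cnfE (NegCNF.decCNF x) = x)) :=
    ((eq hinj).comp (hre.pair (CodeFP.id strE))).congr fun _ => rfl
  exact (htest.ite ((K.cnfInstFP k).comp decCNFFP) (const _ badTab)).congr fun x => by
    unfold reduceETH; rw [cnfE_eq]; simp only [decide_eq_true_eq]

/-- `G_φ`'s edge test is symmetric. [cite: GareyJohnsonStockmeyer1976, Thm 2.1] -/
private theorem cnfAdj_comm (φ : CNF ℕ) (a b : ℕ) : cnfAdj φ a b = cnfAdj φ b a := by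
  unfold cnfAdj BDI20SatGraph.adj
  rw [Bool.or_comm]

/-- Proper `3`-colourings in the crossbar's sense are the proper `3`-colourings of
`BDI20BoundedDegreeSatGraph` (the edge test is symmetric). [cite: GareyJohnsonStockmeyer1976, Thm 2.1] -/
theorem isProperFor_cnfAdj_iff (φ : CNF ℕ) :
    (∃ col : ℕ → Fin 3, Crossbar.IsProperFor (nLab φ.length) (cnfAdj φ) col) ↔
      ∃ c : ℕ → ℕ, (∀ a, c a < 3) ∧ ∀ a b, a < nLab φ.length → b < nLab φ.length →
        pairTest (cnfAdj φ) a b = true → c a ≠ c b := by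
  constructor
  · rintro ⟨col, hcol⟩
    refine ⟨fun a => (col a).val, fun a => (col a).2, fun a b ha hb hab => ?_⟩
    unfold pairTest at hab
    rw [Bool.and_eq_true, decide_eq_true_eq] at hab
    exact fun h => hcol a b ha hb hab.1.ne hab.2 (Fin.ext h)
  · rintro ⟨c, hc3, hc⟩
    refine ⟨fun a => ⟨c a, hc3 a⟩, fun a b ha hb hab hadj h => ?_⟩
    have h' : c a = c b := by simpa using congrArg Fin.val h
    rcases Nat.lt_or_gt_of_ne hab with hlt | hlt
    · exact hc a b ha hb (by unfold pairTest; simp [hlt, hadj]) h'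
    · exact hc b a hb ha (by unfold pairTest; rw [cnfAdj_comm] at hadj; simp [hlt, hadj]) h'.symm

/-- **The instance of a CNF is a yes-instance iff the CNF is a satisfiable `3`-CNF** (`k ≥ 1`, `m ≥ 5`).
[cite: BlaserDorflerIkenmeyer2020, Thm 30 (proof) (arXiv; = CCC 2021 Thm 8.9)] [cite: GareyJohnsonStockmeyer1976, Thm 2.1] -/
theorem cnfInst_mem_iff {k m : ℕ} (hk : 0 < k) (hm : 5 ≤ m) (φ : CNF ℕ) :
    K.cnfInst k φ ∈ nonvanishingSetSemistd (16 * k) m ↔ φ.IsWidthLE 3 ∧ φ.Satisfiable := by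
  unfold cnfInst
  by_cases hg : goodShape φ = true
  · rw [if_pos hg]
    obtain ⟨hne, hw⟩ := (goodShape_iff φ).1 hg
    by_cases he : φ.isEmpty = true
    · rw [if_pos he]
      rw [List.isEmpty_iff] at he
      subst he
      exact ⟨fun _ => ⟨hw, fun _ => false, rfl⟩, fun _ => nil_mem _ m⟩
    · rw [if_neg he, K.inst_mem_iff hk hm, isProperFor_cnfAdj_iff, exists_proper_iff_satisfiable φ hne hw]
      exact ⟨fun h => ⟨hw, h⟩, fun h => h.2⟩
  · rw [if_neg hg]
    refine ⟨fun h => absurd h (badTab_not_mem (by omega)), fun ⟨hw, σ, hσ⟩ => absurd ?_ hg⟩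
    rw [goodShape_iff]
    refine ⟨fun c hc hcn => ?_, hw⟩
    subst hcn
    unfold CNF.eval at hσ
    rw [List.all_eq_true] at hσ
    simpa using hσ [] hc

/-- **Correctness of the Karp map**: `x ∈ 3SAT ⟺ reduceETH k x` is a yes-instance.
[cite: BlaserDorflerIkenmeyer2020, Thm 30 (arXiv; = CCC 2021 Thm 8.9)] -/
theorem mem_kSAT_iff_reduceETH_mem {k m : ℕ} (hk : 0 < k) (hm : 5 ≤ m) (x : List Bool) :
    x ∈ kSAT 3 ↔ K.reduceETH k x ∈ nonvanishingSetSemistd (16 * k) m := by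
  unfold reduceETH
  by_cases hx : encodingCNF.encode (NegCNF.decCNF x) = x
  · rw [if_pos hx, K.cnfInst_mem_iff hk hm]
    conv_lhs => rw [← hx]
    unfold kSAT
    rw [_root_.Computability.Encoding.mem_toLanguage_iff]
    rfl
  · rw [if_neg hx]
    exact ⟨fun h => absurd (KSATRed.encode_decCNF_of_mem h) hx, fun h => absurd h (badTab_not_mem (by omega))⟩

/-- The size constant of the parameter bound. [cite: ImpagliazzoPaturiZaneJCSS2001, §2.1 (SERF: linear parameter)] -/
def ethConst : ℕ := 2 * (5 * 1024 * K.C + 16)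
set_option maxHeartbeats 400000 in -- buildfix (bf3-g27): 160k/180k FAIL, 200k PASS at accept time; line-neutral budget line
/-- **The parameter `√(#labels)` of the instance of a CNF is linear in the number of clauses.**
[cite: BlaserDorflerIkenmeyer2020, Thm 30 (proof: "ℓ ∈ O(|V(G)|)", "in time 2^{o(√ℓ)}") (arXiv; = CCC 2021 Thm 8.9)] [cite: ImpagliazzoPaturiZaneJCSS2001, §2.1] -/
theorem sqrt_numLabels_cnfInst_le (k : ℕ) (φ : CNF ℕ) :
    Nat.sqrt (numLabels (K.cnfInst k φ)) - 1 ≤ K.ethConst * φ.length := by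
  unfold cnfInst
  split_ifs with hg he
  · rw [BDI20ETH.numLabels_nil]; simp
  · have hm : 0 < φ.length := by
      rw [Bool.not_eq_true, List.isEmpty_eq_false_iff, ← List.length_pos_iff] at he; exact he
    have h1 := K.numLabels_inst_le k (nLab φ.length) (cnfAdj φ)
    have h2 := K.size_le (nLab φ.length) (cnfAdj φ)
    set A := 5 * 1024 * K.C + 16 with hA
    -- `numLabels ≤ A (m+1)² ≤ (A (m+1))²`
    have h3 : numLabels (K.inst k (nLab φ.length) (cnfAdj φ)) ≤ (A * (φ.length + 1)) ^ 2 := by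
      have hn : nLab φ.length + 1 ≤ 32 * (φ.length + 1) := by unfold nLab; omega
      have h4 : (nLab φ.length + 1) ^ 2 ≤ 1024 * (φ.length + 1) ^ 2 := by
        calc (nLab φ.length + 1) ^ 2 ≤ (32 * (φ.length + 1)) ^ 2 := Nat.pow_le_pow_left hn 2
          _ = 1024 * (φ.length + 1) ^ 2 := by ring
      have h5 : A * (φ.length + 1) ^ 2 ≤ (A * (φ.length + 1)) ^ 2 := by
        rw [mul_pow]
        exact Nat.mul_le_mul_right _ (by nlinarith)
      nlinarith
    have h6 : Nat.sqrt (numLabels (K.inst k (nLab φ.length) (cnfAdj φ))) ≤ A * (φ.length + 1) := by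
      rw [← Nat.sqrt_eq' (A * (φ.length + 1))]
      exact Nat.sqrt_le_sqrt h3
    have h7 : A * (φ.length + 1) ≤ K.ethConst * φ.length + 1 := by
      unfold ethConst; rw [← hA]; nlinarith
    omega
  · rw [numLabels_badTab]; simp

/-- **The parameter bound on all strings.** [cite: ImpagliazzoPaturiZaneJCSS2001, §2.1 (SERF)] -/
theorem sqrt_numLabels_reduceETH_le (k : ℕ) (x : List Bool) :
    Nat.sqrt (numLabels (K.reduceETH k x)) - 1 ≤ K.ethConst * (kSATClauseParam 3).param x := by
  unfold reduceETH
  by_cases hx : encodingCNF.encode (NegCNF.decCNF x) = x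
  · rw [if_pos hx]
    conv_rhs => rw [← hx, kSATClauseParam_param_encode]
    exact K.sqrt_numLabels_cnfInst_le k _
  · rw [if_neg hx, numLabels_badTab]; simp

/-- **Thm 8.9's ETH clause from a regularisation** (the discharge SHAPE of `BDI2020_thm_8_9_eth`):
under ETH, the polynomial-time Karp map `reduceETH k` from `3`-SAT with `√(#labels) = O(m)` rules out
a `2^{o(√n)}` decider (`BDI20ETH.not_hasSubexpDecider_of_codeFP`: IPZ SERF closure + the proved
sparsification-based `ETH ⟺ 3SAT[m] ∉ SE`). [cite: BlaserDorflerIkenmeyer2020, Thm 30 (arXiv; = CCC 2021 Thm 8.9: "can not be computed in time 2^{o(√n)}")] -/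
theorem thm_8_9_eth_of_regularisation (K : Regularisation) : BDI2020_thm_8_9_eth := by
  intro hETH d m hd hdvd hm
  obtain ⟨k, rfl⟩ := hdvd
  have hk : 0 < k := by omega
  exact BDI20ETH.not_hasSubexpDecider_of_codeFP hETH (T₀ := badTab) (badTab_not_mem (by omega))
    (K.reduceETHFP k) (K.mem_kSAT_iff_reduceETH_mem hk hm) (K.sqrt_numLabels_reduceETH_le k)

end ETHClause

end Regularisation

end Sec8

end BDI2020

end Literature.Computability.AlgebraicComplexity
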